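import Literature.NumberTheory.Automorphic.Liu2021.AppendixC.EtaleH1TowerHeckeEndomorphism
import Literature.AlgebraicGeometry.ComplexMultiplication.TateModuleOfCMFreeRankOne
import HarnessLib

/-!
# [Liu 2021, §4.2 l. 2074 / p. 133 (D.3)] the Hecke ENDOMORPHISM `[KgK] ∈ End⁰(A_K)` of the Albanese variety at level `K` (d6 DEF DH1)

Topic `NumberTheory/Automorphic/Liu2021/AppendixC`; namespace `Literature.NumberTheory.Automorphic.Liu2021.AppendixC.Sec42Data.HeckeTranslates`.
ONE DEFINITION (`heckeEnd`) + theorems; no named fact, no instance, no `sorry`.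

Print, [Liu2021] p. 133 (before (D.3)): «We have a homomorphism `C_c^∞(K\G(𝔸^∞)/K, ℚ) → End(A_K)_ℚ` of ℚ-algebras induced by the Hecke
actions.»  Here `A_K` is the Albanese variety of the level-`K` Shimura variety and `End(A_K)_ℚ = End⁰(A_K) = ℚ ⊗ End(A_K)` (the tree's
`AbelianVariety.endAlgebra`).  This file constructs the value of that homomorphism on the double coset `KgK`:

* `heckeEnd T hD K g : (C.A K).endAlgebra` — the element `m⁻¹ ⊗ ψ_g`, where `m ≠ 0` and the HONEST endomorphism `ψ_g : A_K ⟶ A_K` over the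
  reflex field satisfy `Alb_{u^N_K} ≫ ψ_g = m • Σ_{γK ⊆ KgK} Alb(T_γ)` for a small normal level `N ⊆ K` (★ `EtaleH1TowerHeckeEndomorphism` /
  ★ `BettiPinningHeckeEndomorphism`, from row (D) `T.IsogenyDescent`).  The pair `(m, ψ_g)` is CHOSEN (row (D) is an `∃`-predicate), but the
  element of `End⁰(A_K)` is choice-independent and `ℓ`-free: it is characterised by its `ℓ`-adic shadow (uniqueness below).
* `heckeEnd_spec` — the defining property packaged once: `heckeEnd = m⁻¹ · (1 ⊗ ψ)` with, for EVERY prime `ℓ`, `[ᵗV_ℓ(ψ) φ]_K = m • [KgK][φ]_K`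
  on `H¹_ét` and, for EVERY Betti pinning `B`, `b_K(ψ^* y) = m • [KgK](b_K y)` on `H¹_B`.
* `toTower_dualMap_rationalTateAction_heckeEnd` — `[ᵗ(V_ℓ^ℚ heckeEnd) φ]_K = [KgK] [φ]_K` (`V_ℓ^ℚ = AbelianVariety.rationalTateAction`), and its
  `LinearMap` / `R ⊗`-base-changed forms.
* `Sec42Data.endAlgebra_eq_of_forall_toTower_eq`, `eq_heckeEnd` — UNIQUENESS: an element of `End⁰(A_K)` is determined by the action of
  `ᵗV_ℓ^ℚ` on `H¹_ét(A_∞)` (★ `rationalTateAction_injective` + ★ `Sec42Data.toTower_injective hI`); hence `heckeEnd` is THE element acting as `[KgK]`.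
* `heckeEnd_of_mem`, `heckeEnd_one` — `heckeEnd K k = 1` for `k ∈ K`.

DICTIONARY LINE (cell `hodgecm-mathlib`, crux `HLiu418` = stmt-HodgeConjecture-24832, d6 HOME card v3.4 S2′, census `CENSUS-DH1-DH2.A-p09g13.md` §DH1):
for the curve tower `hD := isogenyDescent_GS`, `hI := hI_GS`; DH2 `heckeImage := Algebra.adjoin ℚ (range heckeEnd)` and its semisimplicity
(door (β), ★ `SemisimpleOfFaithfulModule`) are the sequel.  The file moves no book (HC_CM is proved only modulo the 7 printed citations until
rung 0 closes).

## References
* [Liu2021] Y. Liu, *Fourier–Jacobi cycles and arithmetic relative trace formula*, Camb. J. Math. 9 (2021): §4.2 (FJcycle.tex l. 2070–2081, esp.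
  l. 2074), p. 133 (before (D.3)), Thm. 4.18 (1) proof (l. 2248–2270).
* [Bump1997] D. Bump, *Automorphic Forms and Representations* (1997), §4.2 Prop. 4.2.3 (`[KgK]` as a sum over `KgK/K`).
* [MumfordAV1970] D. Mumford, *Abelian Varieties*, §19 Thm. 3 (`End A → End T_ℓ A` injective).
-/

set_option autoImplicit false

noncomputable section

open CategoryTheory NumberField Function MulAction
open scoped TensorProduct

namespace Literature.NumberTheory.Automorphic.Liu2021.AppendixC

open Literature.AlgebraicGeometry.Motives (AbelianVariety)
open Literature.AlgebraicGeometry.Motives.AbelianVariety (rationalTateModuleMap rationalTateModuleMap_comp rationalTateModuleMap_add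
  endAlgebra rationalTateAction rationalTateAction_of rationalTateAction_algebraMap rationalTateAction_injective)

variable {F E : Type} [Field F] [NumberField F] [IsTotallyReal F] [Field E] [NumberField E] [Algebra F E]
  [IsTotallyComplex E] [Algebra.IsQuadraticExtension F E]
variable {P5 : PropC5Data F E} {isotropicAt : ℕ → Prop}

namespace Sec42Data.HeckeTranslates

variable {C : Sec42Data P5 isotropicAt} (T : C.HeckeTranslates)

/-! ## §0 The geometric datum behind `[KgK]`: `Alb_u ≫ ψ = m • Σ_γ Alb(T_γ)`, read on `H¹_ét` for every `ℓ` and on `H¹_B` for every pinning -/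

/-- **The geometric datum** (private packaging of ★ `exists_hom_toTower_dualMap_eq_smul_heckeOperator` and ★
`BettiPinning.exists_hom_b_bettiPullAlong_eq_smul_heckeOperator` with ONE common witness): granted row (D), for every small level `K` and
every `g` there are `m ≠ 0` and an honest `ψ : A_K ⟶ A_K` such that SIMULTANEOUSLY `[ᵗV_ℓ(ψ) φ]_K = m • [KgK][φ]_K` for every prime `ℓ` and
every `φ`, and `b_K(ψ^* y) = m • [KgK](b_K y)` for every Betti pinning `B` and every `y` — both being the shadow of the one identity
`Alb_{u^N_K} ≫ ψ = m • Σ_{γK ⊆ KgK} Alb(T_γ)`. [cite: Liu2021, §4.2 (FJcycle.tex l. 2074) and Thm. 4.18 (1) proof (l. 2248–2270)]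
[cite: Bump1997, §4.2 (Prop. 4.2.3, proof)] -/
theorem exists_hom_etale_and_betti_eq_smul_heckeOperator (hD : T.IsogenyDescent) (K : C5.SmallLevel C.S.K₀) (g : C.G) :
    ∃ (m : ℤ) (ψ : C.A K ⟶ C.A K), m ≠ 0 ∧
      (∀ (ℓ : ℕ) [Fact ℓ.Prime] (φ : C.etaleH1 ℓ K),
        C.toTower ℓ K ((rationalTateModuleMap ℓ ψ).dualMap φ) =
          (m : ℚ_[ℓ]) • Literature.NumberTheory.Automorphic.heckeOperator (T.etHeckeRep ℓ) (K.1.1 : Subgroup C.G) g (C.toTower ℓ K φ)) ∧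
      (∀ (τ' : E →+* ℂ) (H : Type) [AddCommGroup H] [Module ℂ H] (rhoB : Representation ℂ C.G H) (B : C.BettiPinning T τ' H rhoB)
        (y : C.bettiH1 τ' K),
        B.b K (bettiPullAlong τ' ψ y) =
          (m : ℂ) • Literature.NumberTheory.Automorphic.heckeOperator rhoB (K.1.1 : Subgroup C.G) g (B.b K y)) := by
  classical
  -- the finite set of cosets `γK ⊆ KgK` and representatives
  have hfin := Sec42Data.BettiPinning.finite_orbit_level K g
  haveI : Fintype (orbit K.1.1 (g : C.G ⧸ (K.1.1 : Subgroup C.G))) := hfin.fintype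
  let rep : orbit K.1.1 (g : C.G ⧸ (K.1.1 : Subgroup C.G)) → C.G := fun α => (α.1).out
  -- a common admissible normal source level
  obtain ⟨N, hNK, hN, hγ⟩ := C5.SmallLevel.exists_normal_le_forall_heckeLE (Finset.univ.image rep) K
  have hrep : ∀ α, C5.HeckeLE (rep α) N K := fun α => hγ _ (Finset.mem_image_of_mem rep (Finset.mem_univ α))
  -- the translates as a function on the cosets, and their sum
  let a : orbit K.1.1 (g : C.G ⧸ (K.1.1 : Subgroup C.G)) → (C.A N ⟶ C.A K) := fun α => T.albTr (rep α) N K (hrep α)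
  have hka : ∀ (k : C.G) (hk : k ∈ K.1.1) (α : orbit K.1.1 (g : C.G ⧸ (K.1.1 : Subgroup C.G))),
      T.albTr k N N (hN k hk) ≫ a α = a ((⟨k, hk⟩ : K.1.1) • α) := by
    intro k hk α
    rw [T.albTr_mul k (rep α) (hN k hk) (hrep α)]
    refine T.albTr_eq_of_coe_eq _ _ ?_
    have h1 : ((k * rep α : C.G) : C.G ⧸ (K.1.1 : Subgroup C.G)) = ((⟨k, hk⟩ : K.1.1) • α : orbit K.1.1 _).1 := by
      rw [orbit.coe_smul, ← QuotientGroup.out_eq' α.1]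
      rfl
    rw [h1]
    exact (QuotientGroup.out_eq' _).symm
  let Φ : C.A N ⟶ C.A K := ∑ α, a α
  have hΦ : ∀ (k : C.G) (hk : k ∈ K.1.1), T.albTr k N N (hN k hk) ≫ Φ = Φ := by
    intro k hk
    show T.albTr k N N (hN k hk) ≫ ∑ α, a α = ∑ α, a α
    rw [Preadditive.comp_sum]
    exact (Finset.sum_congr rfl fun α _ => hka k hk α).trans (Equiv.sum_comp (MulAction.toPerm (⟨k, hk⟩ : K.1.1)) a)
  -- descent up to isogeny: ONE witness for both shadows
  obtain ⟨m, ψ, hm, hψ⟩ := hD hNK hN (C.A K) Φ hΦ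
  refine ⟨m, ψ, hm, fun ℓ _ φ => ?_, fun τ' H _ _ rhoB B y => ?_⟩
  · -- étale shadow (the tail of ★ `exists_hom_toTower_dualMap_eq_smul_heckeOperator`)
    let Vh : (C.A N ⟶ C.A K) →+ ((C.A N).rationalTateModule ℓ →ₗ[ℚ_[ℓ]] (C.A K).rationalTateModule ℓ) :=
      AddMonoidHom.mk' (fun f => rationalTateModuleMap ℓ f) (rationalTateModuleMap_add ℓ)
    have h1 : C.toTower ℓ K ((rationalTateModuleMap ℓ ψ).dualMap φ) =
        C.toTower ℓ N ((rationalTateModuleMap ℓ (C.Atr (homOfLE hNK) ≫ ψ)).dualMap φ) := by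
      rw [rationalTateModuleMap_comp, ← LinearMap.dualMap_comp_dualMap, LinearMap.comp_apply, C.toTower_pull ℓ (homOfLE hNK)]
    have h2 : (rationalTateModuleMap ℓ (C.Atr (homOfLE hNK) ≫ ψ)).dualMap φ =
        (m : ℚ_[ℓ]) • ∑ α, (rationalTateModuleMap ℓ (a α)).dualMap φ := by
      rw [hψ]
      have e1 : rationalTateModuleMap ℓ (m • Φ) = m • ∑ α, rationalTateModuleMap ℓ (a α) := by
        show Vh (m • ∑ α, a α) = _
        rw [map_zsmul, map_sum]
        rfl
      apply LinearMap.ext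
      intro v
      rw [LinearMap.dualMap_apply, e1, LinearMap.smul_apply, LinearMap.sum_apply, map_zsmul, map_sum, LinearMap.smul_apply,
        LinearMap.sum_apply, ← Int.cast_smul_eq_zsmul ℚ_[ℓ] m]
      congr 1
    have h3 : ∀ α, C.toTower ℓ N ((rationalTateModuleMap ℓ (a α)).dualMap φ) = T.etHeckeRep ℓ (rep α) (C.toTower ℓ K φ) := fun α =>
      (T.etHecke_toTower ℓ (rep α) (hrep α) φ).symm
    rw [h1, h2, map_smul, map_sum]
    simp_rw [h3]
    congr 1
    have hfix : C.toTower ℓ K φ ∈ (T.etHeckeRep ℓ).fixedPoints (K.1.1 : Subgroup C.G) :=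
      ((T.etHeckeRep ℓ).mem_fixedPoints K.1.1 (C.toTower ℓ K φ)).2 fun _ hk => T.etHeckeRep_toTower_of_mem ℓ hk φ
    rw [Literature.NumberTheory.Automorphic.heckeOperator_apply_eq_sum_out (T.etHeckeRep ℓ) (K.1.1 : Subgroup C.G) g hfin hfix,
      ← Finset.sum_coe_sort hfin.toFinset]
    exact Fintype.sum_equiv (Equiv.subtypeEquivRight fun x => hfin.mem_toFinset.symm) _ _ fun α => rfl
  · -- Betti shadow (the tail of ★ `BettiPinning.exists_hom_b_bettiPullAlong_eq_smul_heckeOperator`)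
    have h1 : B.b K (bettiPullAlong τ' ψ y) = B.b N (bettiPullAlong τ' (C.Atr (homOfLE hNK) ≫ ψ) y) := by
      rw [bettiPullAlong_comp_apply, B.b_bettiPullAlong_Atr]
    have h2 : bettiPullAlong τ' (C.Atr (homOfLE hNK) ≫ ψ) y = (m : ℂ) • ∑ α, bettiPullAlong τ' (a α) y := by
      rw [hψ, bettiPullAlong_zsmul, LinearMap.smul_apply, ← Int.cast_smul_eq_zsmul ℂ m]
      congr 1
      show bettiPullAlong τ' (∑ α, a α) y = _
      rw [bettiPullAlong_sum, LinearMap.sum_apply]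
    have h3 : ∀ α, B.b N (bettiPullAlong τ' (a α) y) = rhoB (rep α) (B.b K y) := fun α =>
      (B.b_hecke (rep α) N K (hrep α) y).symm
    rw [h1, h2, map_smul, map_sum]
    simp_rw [h3]
    congr 1
    rw [Literature.NumberTheory.Automorphic.heckeOperator_apply_eq_sum_out rhoB (K.1.1 : Subgroup C.G) g hfin
      (B.b_mem_fixedPoints K y), ← Finset.sum_coe_sort hfin.toFinset]
    exact Fintype.sum_equiv (Equiv.subtypeEquivRight fun x => hfin.mem_toFinset.symm) _ _ fun α => rfl

/-! ## §1 The definition -/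

/-- **DH1 — the Hecke endomorphism `[KgK] ∈ End⁰(A_K)`**: the element `m⁻¹ ⊗ ψ_g` of `End(A_K)_ℚ = ℚ ⊗ End A_K` for the chosen witness
`(m, ψ_g)` of §0 — «the homomorphism `C_c^∞(K\G(𝔸^∞)/K, ℚ) → End(A_K)_ℚ` induced by the Hecke actions» evaluated at `𝟙_{KgK}`.  The choice is
immaterial: `heckeEnd` is the unique element whose `ℓ`-adic realisation acts as `[KgK]` on `H¹_ét` (`eq_heckeEnd`).
[cite: Liu2021, p. 133 (before (D.3)) and §4.2 (FJcycle.tex l. 2074)] -/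
def heckeEnd (hD : T.IsogenyDescent) (K : C5.SmallLevel C.S.K₀) (g : C.G) : (C.A K).endAlgebra :=
  algebraMap ℚ (C.A K).endAlgebra ((T.exists_hom_etale_and_betti_eq_smul_heckeOperator hD K g).choose : ℚ)⁻¹ *
    endAlgebra.of (C.A K) (T.exists_hom_etale_and_betti_eq_smul_heckeOperator hD K g).choose_spec.choose

/-- **The defining property of `heckeEnd`**, unpacked: there are `m ≠ 0` and `ψ : A_K ⟶ A_K` with `heckeEnd = m⁻¹ · (1 ⊗ ψ)`,
`[ᵗV_ℓ(ψ) φ]_K = m • [KgK][φ]_K` for every prime `ℓ`, and `b_K(ψ^* y) = m • [KgK](b_K y)` for every Betti pinning.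
[cite: Liu2021, §4.2 (FJcycle.tex l. 2074) and Thm. 4.18 (1) proof (l. 2248–2270)] -/
theorem heckeEnd_spec (hD : T.IsogenyDescent) (K : C5.SmallLevel C.S.K₀) (g : C.G) :
    ∃ (m : ℤ) (ψ : C.A K ⟶ C.A K), m ≠ 0 ∧
      T.heckeEnd hD K g = algebraMap ℚ (C.A K).endAlgebra (m : ℚ)⁻¹ * endAlgebra.of (C.A K) ψ ∧
      (∀ (ℓ : ℕ) [Fact ℓ.Prime] (φ : C.etaleH1 ℓ K),
        C.toTower ℓ K ((rationalTateModuleMap ℓ ψ).dualMap φ) =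
          (m : ℚ_[ℓ]) • Literature.NumberTheory.Automorphic.heckeOperator (T.etHeckeRep ℓ) (K.1.1 : Subgroup C.G) g (C.toTower ℓ K φ)) ∧
      (∀ (τ' : E →+* ℂ) (H : Type) [AddCommGroup H] [Module ℂ H] (rhoB : Representation ℂ C.G H) (B : C.BettiPinning T τ' H rhoB)
        (y : C.bettiH1 τ' K),
        B.b K (bettiPullAlong τ' ψ y) =
          (m : ℂ) • Literature.NumberTheory.Automorphic.heckeOperator rhoB (K.1.1 : Subgroup C.G) g (B.b K y)) :=
  let h := T.exists_hom_etale_and_betti_eq_smul_heckeOperator hD K g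
  ⟨h.choose, h.choose_spec.choose, h.choose_spec.choose_spec.1, rfl, h.choose_spec.choose_spec.2.1, h.choose_spec.choose_spec.2.2⟩

/-! ## §2 The `ℓ`-adic realisation of `heckeEnd` IS the Hecke operator -/

section Etale

variable (ℓ : ℕ) [Fact ℓ.Prime]

/-- the dual of a scalar multiple (pointwise bookkeeping). [folklore] -/
private theorem dualMap_smul_apply {V : Type*} [AddCommGroup V] [Module ℚ_[ℓ] V] (c : ℚ_[ℓ]) (f : V →ₗ[ℚ_[ℓ]] V)
    (φ : Module.Dual ℚ_[ℓ] V) : (c • f).dualMap φ = c • f.dualMap φ := by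
  ext v
  simp only [LinearMap.dualMap_apply, LinearMap.smul_apply, map_smul, smul_eq_mul]

/-- **`[ᵗ(V_ℓ^ℚ [KgK]) φ]_K = [KgK] [φ]_K`**: on `H¹_ét(A_∞)` the `ℓ`-adic realisation `V_ℓ^ℚ = rationalTateAction` of the Hecke endomorphism
acts, through the level map `[·]_K`, as the Hecke operator of the induced étale action — for EVERY prime `ℓ`.
[cite: Liu2021, §4.2 (FJcycle.tex l. 2074, 2154–2160)] [cite: MumfordAV1970, §19 Thm. 3] -/
theorem toTower_dualMap_rationalTateAction_heckeEnd (hD : T.IsogenyDescent) (K : C5.SmallLevel C.S.K₀) (g : C.G) (φ : C.etaleH1 ℓ K) :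
    C.toTower ℓ K ((rationalTateAction (C.A K) ℓ (T.heckeEnd hD K g)).dualMap φ) =
      Literature.NumberTheory.Automorphic.heckeOperator (T.etHeckeRep ℓ) (K.1.1 : Subgroup C.G) g (C.toTower ℓ K φ) := by
  obtain ⟨m, ψ, hm, heq, het, -⟩ := T.heckeEnd_spec hD K g
  have hV : rationalTateAction (C.A K) ℓ (T.heckeEnd hD K g) = ((m : ℚ_[ℓ]))⁻¹ • rationalTateModuleMap ℓ ψ := by
    rw [heq, map_mul, rationalTateAction_algebraMap, rationalTateAction_of, ← Algebra.smul_def, map_inv₀, map_intCast]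
  have hm' : (m : ℚ_[ℓ]) ≠ 0 := Int.cast_ne_zero.2 hm
  rw [hV, dualMap_smul_apply, map_smul, het ℓ φ, smul_smul, inv_mul_cancel₀ hm', one_smul]

/-- The same as an identity of linear maps `[·]_K ∘ ᵗ(V_ℓ^ℚ [KgK]) = [KgK] ∘ [·]_K`. [cite: Liu2021, §4.2 (FJcycle.tex l. 2074)] -/
theorem toTower_comp_dualMap_rationalTateAction_heckeEnd (hD : T.IsogenyDescent) (K : C5.SmallLevel C.S.K₀) (g : C.G) :
    C.toTower ℓ K ∘ₗ (rationalTateAction (C.A K) ℓ (T.heckeEnd hD K g)).dualMap =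
      Literature.NumberTheory.Automorphic.heckeOperator (T.etHeckeRep ℓ) (K.1.1 : Subgroup C.G) g ∘ₗ C.toTower ℓ K :=
  LinearMap.ext fun φ => T.toTower_dualMap_rationalTateAction_heckeEnd ℓ hD K g φ

/-- **Base-changed form** (for values of `f′ ∈ omegaHom`, which live in `R ⊗ H¹_ét`, `R = ℚ_ℓ^{ac}`):
`(1 ⊗ [·]_K) ((1 ⊗ ᵗ(V_ℓ^ℚ [KgK])) x) = (1 ⊗ [KgK]) ((1 ⊗ [·]_K) x)`. [cite: Liu2021, §4.2 (FJcycle.tex l. 2074, 2160–2165)] -/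
theorem toTower_baseChange_dualMap_rationalTateAction_heckeEnd (hD : T.IsogenyDescent) (K : C5.SmallLevel C.S.K₀) (g : C.G)
    (R : Type) [CommRing R] [Algebra ℚ_[ℓ] R] (x : R ⊗[ℚ_[ℓ]] C.etaleH1 ℓ K) :
    (C.toTower ℓ K).baseChange R (((rationalTateAction (C.A K) ℓ (T.heckeEnd hD K g)).dualMap).baseChange R x) =
      (Literature.NumberTheory.Automorphic.heckeOperator (T.etHeckeRep ℓ) (K.1.1 : Subgroup C.G) g).baseChange R
        ((C.toTower ℓ K).baseChange R x) := by
  have := congrArg (fun (L : C.etaleH1 ℓ K →ₗ[ℚ_[ℓ]] C.etaleH1Tower ℓ) => (L.baseChange R) x)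
    (T.toTower_comp_dualMap_rationalTateAction_heckeEnd ℓ hD K g)
  simpa only [LinearMap.baseChange_comp, LinearMap.comp_apply] using this

/-! ## §3 Uniqueness: an element of `End⁰(A_K)` is determined by its action on `H¹_ét(A_∞)` -/

/-- **Faithfulness**: if two elements of `End⁰(A_K)` induce the same map on `H¹_ét(A_∞)` through `[·]_K ∘ ᵗV_ℓ^ℚ`, they are equal — granted
injective étale pull-backs along the tower (`hI`, so `[·]_K` is injective ★ `Sec42Data.toTower_injective`), since `ᵗ` and
`V_ℓ^ℚ : End⁰(A_K) → End(V_ℓ A_K)` (★ `rationalTateAction_injective`) are injective. [cite: MumfordAV1970, §19 Thm. 3] [cite: Liu2021, §4.2 (FJcycle.tex l. 2158)] -/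
theorem _root_.Literature.NumberTheory.Automorphic.Liu2021.AppendixC.Sec42Data.endAlgebra_eq_of_forall_toTower_eq
    (C : Sec42Data P5 isotropicAt)
    (hI : ∀ ⦃K K' : C5.SmallLevel C.S.K₀⦄ (f : K' ⟶ K), Function.Injective (rationalTateModuleMap ℓ (C.Atr f)).dualMap)
    (K : C5.SmallLevel C.S.K₀) {x y : (C.A K).endAlgebra}
    (h : ∀ φ : C.etaleH1 ℓ K, C.toTower ℓ K ((rationalTateAction (C.A K) ℓ x).dualMap φ) =
      C.toTower ℓ K ((rationalTateAction (C.A K) ℓ y).dualMap φ)) : x = y := by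
  have hℓ : (ℓ : E) ≠ 0 := Nat.cast_ne_zero.2 (Fact.out : ℓ.Prime).ne_zero
  refine rationalTateAction_injective (A := C.A K) (ℓ := ℓ) hℓ (LinearMap.ext fun v => ?_)
  rw [← sub_eq_zero]
  refine (Module.forall_dual_apply_eq_zero_iff ℚ_[ℓ]
    (rationalTateAction (C.A K) ℓ x v - rationalTateAction (C.A K) ℓ y v)).1 fun φ => ?_
  have hφ : (rationalTateAction (C.A K) ℓ x).dualMap φ = (rationalTateAction (C.A K) ℓ y).dualMap φ :=
    C.toTower_injective ℓ hI K (h φ)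
  have := LinearMap.congr_fun hφ v
  rw [LinearMap.dualMap_apply, LinearMap.dualMap_apply] at this
  rw [map_sub, this, sub_self]

/-- **`heckeEnd` is THE element of `End⁰(A_K)` acting as `[KgK]` on `H¹_ét(A_∞)`** (choice-independence of the definition).
[cite: Liu2021, p. 133 (before (D.3)) and §4.2 (FJcycle.tex l. 2074)] [cite: MumfordAV1970, §19 Thm. 3] -/
theorem eq_heckeEnd (hD : T.IsogenyDescent)
    (hI : ∀ ⦃K K' : C5.SmallLevel C.S.K₀⦄ (f : K' ⟶ K), Function.Injective (rationalTateModuleMap ℓ (C.Atr f)).dualMap)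
    (K : C5.SmallLevel C.S.K₀) (g : C.G) {x : (C.A K).endAlgebra}
    (hx : ∀ φ : C.etaleH1 ℓ K, C.toTower ℓ K ((rationalTateAction (C.A K) ℓ x).dualMap φ) =
      Literature.NumberTheory.Automorphic.heckeOperator (T.etHeckeRep ℓ) (K.1.1 : Subgroup C.G) g (C.toTower ℓ K φ)) :
    x = T.heckeEnd hD K g :=
  C.endAlgebra_eq_of_forall_toTower_eq ℓ hI K fun φ => by
    rw [hx φ, T.toTower_dualMap_rationalTateAction_heckeEnd ℓ hD K g φ]

/-! ## §4 The level acts trivially: `heckeEnd K k = 1` for `k ∈ K` -/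

/-- For `k ∈ K` the double coset `KkK = K` is the trivial one and `heckeEnd K k = 1` (`[K] = id` on `K`-fixed classes,
★ `heckeOperator_one_apply`). [cite: Liu2021, §4.2 (FJcycle.tex l. 2070–2074) and Thm. 4.18 (1) (l. 2239)] [cite: Bump1997, §4.2 (Prop. 4.2.3)] -/
theorem heckeEnd_of_mem (hD : T.IsogenyDescent)
    (hI : ∀ ⦃K K' : C5.SmallLevel C.S.K₀⦄ (f : K' ⟶ K), Function.Injective (rationalTateModuleMap ℓ (C.Atr f)).dualMap)
    (K : C5.SmallLevel C.S.K₀) {k : C.G} (hk : k ∈ K.1.1) : T.heckeEnd hD K k = 1 := by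
  symm
  refine T.eq_heckeEnd ℓ hD hI K k fun φ => ?_
  have hfix : C.toTower ℓ K φ ∈ (T.etHeckeRep ℓ).fixedPoints (K.1.1 : Subgroup C.G) :=
    ((T.etHeckeRep ℓ).mem_fixedPoints K.1.1 (C.toTower ℓ K φ)).2 fun _ hk' => T.etHeckeRep_toTower_of_mem ℓ hk' φ
  have hcoset : ((k : C.G) : C.G ⧸ (K.1.1 : Subgroup C.G)) = ((1 : C.G) : C.G ⧸ (K.1.1 : Subgroup C.G)) := by
    rw [QuotientGroup.eq, mul_one]
    exact inv_mem hk
  have hop : Literature.NumberTheory.Automorphic.heckeOperator (T.etHeckeRep ℓ) (K.1.1 : Subgroup C.G) k =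
      Literature.NumberTheory.Automorphic.heckeOperator (T.etHeckeRep ℓ) (K.1.1 : Subgroup C.G) 1 := by
    simp only [Literature.NumberTheory.Automorphic.heckeOperator, hcoset]
  rw [map_one, hop, Literature.NumberTheory.Automorphic.heckeOperator_one_apply _ _ hfix]
  rfl

/-- In particular `heckeEnd K 1 = 1`. [cite: Liu2021, §4.2 (FJcycle.tex l. 2070–2074)] [cite: Bump1997, §4.2 (Prop. 4.2.3)] -/
theorem heckeEnd_one (hD : T.IsogenyDescent)
    (hI : ∀ ⦃K K' : C5.SmallLevel C.S.K₀⦄ (f : K' ⟶ K), Function.Injective (rationalTateModuleMap ℓ (C.Atr f)).dualMap)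
    (K : C5.SmallLevel C.S.K₀) : T.heckeEnd hD K 1 = 1 :=
  T.heckeEnd_of_mem ℓ hD hI K (one_mem _)

end Etale

end Sec42Data.HeckeTranslates

end Literature.NumberTheory.Automorphic.Liu2021.AppendixC

end
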